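import Literature.Barriers.CriticalPhenomena.TimarHeightsQuasiTransitive
import HarnessLib

/-!
# Timár 2006, §4 (set-up of Thm. 4.3) on quasi-transitive graphs: the level grid, long-edge
# paths, slabs `G(ℓ_{j+1}, ℓ_j]` and their separating property for a height system — PROVED

Barrier catalogue `Literature/Barriers/CriticalPhenomena/`; the quasi-transitive twin of
`TimarLevelGrid.lean` (which is written for TRANSITIVE graphs and the weights `autWeight G o`
with `Δ = minNbrWeight G o`). Here the weights are replaced by the heights `h = η.height` of a
height system `η : HeightSystem G o` (`TimarHeightsQuasiTransitive.lean`: an `Aut(G)`-invariant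
re-gauging of the weights with `h(o) = 1`, a ratio `Δ = η.ratio ∈ (0, 1)`, `Δ h(x) ≤ h(y)` along
every edge and a long edge — to height exactly `Δ h(x)` — at every vertex; such a system exists
on every connected, locally finite, quasi-transitive, nonunimodular graph,
`exists_heightSystem`). With this substitution the proofs of `TimarLevelGrid.lean` go through
word for word, transitivity being used there only through the two properties just listed
(Á. Timár, *Percolation on nonunimodular transitive graphs*, Ann. Probab. 34 (2006) 2344–2364,
proof of Thm. 4.3, pp. 2353–2355: "let `ℓ_i` be the level with weight `Δ^i`. Note that
`(G(ℓ_{i+1}, ℓ_i])_i` is a sequence of separating sets of levels").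

PROVED, for `η : HeightSystem G o` on a connected locally finite graph:

* long-edge paths: from every `x` a walk of length `n` to a vertex of height `Δ^n h(x)`
  (`HeightSystem.exists_walk_height_eq_pow`), so every level `{h = Δ^n}` is nonempty;
* the slabs `η.slab j = {v : Δ^{j+1} < h(v) ≤ Δ^j}`: `o ∈ slab 0`, pairwise disjoint, every
  vertex of height `≤ 1` lies in exactly one of them (`exists_unique_mem_slab`), and **the slabs
  separate**: a walk from height `> Δ^j` to height `≤ Δ^j` visits `slab j`
  (`exists_mem_support_mem_slab`); an edge never skips a slab; a long edge from `slab j` lands in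
  `slab (j+1)`;
* slabs of arbitrary position `η.heightSlab a b = {a < h ≤ b}` with the same separation property
  when `a ≤ Δ b` (`exists_mem_heightSlab_of_walk`), and the descending long-edge sequence
  `η.downSeq x` (heights `Δ^n h(x)`, injective) — the quasi-transitive twins of the pieces of
  `TimarSlabs.lean` used by the proof of Thm. 4.3.

## References

* Á. Timár, Ann. Probab. 34 (2006) 2344–2364 (arXiv:math/0702875), §4: p. 2352 (`G(ℓ', ℓ]`),
  p. 2353 (separating sets of levels), pp. 2354–2355 (proof of Thm. 4.3: `ℓ_1`, long edges, `Δ`,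
  `ℓ_i`); §5 (slabs). [Timar2006]
* T. Hutchcroft, C. R. Math. Acad. Sci. Paris 354 (2016) 944–947, §2 (the quasi-transitive
  quotation of Timár's theorem). [Hutchcroft2016]
-/

noncomputable section

namespace Literature.Barriers.CriticalPhenomena

open scoped _root_.ENNReal

variable {V : Type*}

namespace HeightSystem

variable {G : SimpleGraph V} {o : V}

/-! ### `Δ` -/

/-- `Δ ≠ ⊤`. [folklore] -/
theorem ratio_ne_top (η : HeightSystem G o) : η.ratio ≠ ⊤ := ne_top_of_lt η.ratio_lt_one

/-- `0 < Δ`. [folklore] -/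
theorem ratio_pos (η : HeightSystem G o) : 0 < η.ratio := pos_iff_ne_zero.2 η.ratio_ne_zero

/-- Powers of `Δ ∈ (0, 1)` decrease strictly. [folklore] -/
theorem ratio_pow_lt_pow (η : HeightSystem G o) {m n : ℕ} (h : m < n) : η.ratio ^ n < η.ratio ^ m := by
  obtain ⟨k, rfl⟩ := Nat.exists_eq_add_of_lt h
  have h0 : η.ratio ^ m ≠ 0 := pow_ne_zero _ η.ratio_ne_zero
  have hT : η.ratio ^ m ≠ ⊤ := ENNReal.pow_ne_top η.ratio_ne_top
  calc η.ratio ^ (m + k + 1) = η.ratio ^ m * η.ratio ^ (k + 1) := by ring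
    _ < η.ratio ^ m * 1 :=
        ENNReal.mul_lt_mul_right h0 hT (pow_lt_one' η.ratio_lt_one (Nat.succ_ne_zero k))
    _ = η.ratio ^ m := mul_one _

/-- Powers of `Δ ∈ (0, 1)` are antitone, iff form. [folklore] -/
theorem ratio_pow_le_pow_iff (η : HeightSystem G o) {m n : ℕ} :
    η.ratio ^ n ≤ η.ratio ^ m ↔ m ≤ n := by
  constructor
  · intro h
    by_contra hlt
    exact absurd h (not_le.2 (η.ratio_pow_lt_pow (not_le.1 hlt)))
  · intro h
    exact pow_le_pow_right_of_le_one' η.ratio_lt_one.le h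

/-- Powers of `Δ` are nonzero. [folklore] -/
theorem ratio_pow_ne_zero (η : HeightSystem G o) (n : ℕ) : η.ratio ^ n ≠ 0 :=
  pow_ne_zero _ η.ratio_ne_zero

/-- Powers of `Δ` are finite. [folklore] -/
theorem ratio_pow_ne_top (η : HeightSystem G o) (n : ℕ) : η.ratio ^ n ≠ ⊤ :=
  ENNReal.pow_ne_top η.ratio_ne_top

/-- Symmetrically `Δ · h(y) ≤ h(x)` for `x ∼ y`: the height rises along an edge by at most the
factor `Δ⁻¹`. [cite: Timar2006, §4 (proof of Thm. 4.3)] -/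
theorem ratio_mul_height_le' (η : HeightSystem G o) {x y : V} (hxy : G.Adj x y) :
    η.ratio * η.height y ≤ η.height x :=
  η.ratio_mul_height_le hxy.symm

/-! ### Long-edge paths and the levels `ℓ_n` -/

/-- **The levels `ℓ_n` (height `Δ^n h(x)` below any `x`) are reached by paths of long edges**:
for every `x` and `n` there is a walk of length `n` from `x` to a vertex of height `Δ^n h(x)`.
[cite: Timar2006, §4 (proof of Thm. 4.3: "let ℓ_i be the level with weight Δ^i")] -/
theorem exists_walk_height_eq_pow (η : HeightSystem G o) (x : V) (n : ℕ) :
    ∃ (y : V) (p : G.Walk x y), p.length = n ∧ η.height y = η.ratio ^ n * η.height x := by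
  induction n with
  | zero => exact ⟨x, SimpleGraph.Walk.nil, rfl, by rw [pow_zero, one_mul]⟩
  | succ n ih =>
    obtain ⟨y, p, hp, hy⟩ := ih
    obtain ⟨z, hyz, hz⟩ := η.exists_adj_height_eq y
    refine ⟨z, p.append (SimpleGraph.Walk.cons hyz SimpleGraph.Walk.nil), ?_, ?_⟩
    · rw [SimpleGraph.Walk.length_append, hp]; rfl
    · rw [hz, hy, pow_succ]; ring

/-- In particular every level `ℓ_n = {v : h(v) = Δ^n}` (`n ∈ ℕ`) is nonempty.
[cite: Timar2006, §4 (proof of Thm. 4.3: the levels ℓ_i)] -/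
theorem exists_height_eq_pow [G.LocallyFinite] (η : HeightSystem G o) (hconn : G.Connected) (n : ℕ) :
    ∃ y : V, η.height y = η.ratio ^ n := by
  obtain ⟨y, -, -, hy⟩ := η.exists_walk_height_eq_pow o n
  exact ⟨y, by rw [hy, η.height_base hconn, mul_one]⟩

/-! ### Slabs `G(ℓ_{j+1}, ℓ_j]` and their separating property -/

/-- The **slab** `G(ℓ_{j+1}, ℓ_j]`: the vertices of height in `(Δ^{j+1}, Δ^j]` ("the set of
vertices above `ℓ'` and below `ℓ` together with `ℓ` (but not including `ℓ'`) will be called the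
vertices *between* `ℓ` and `ℓ'`", Timár 2006, §4, with `ℓ = ℓ_j`, `ℓ' = ℓ_{j+1}`).
[cite: Timar2006, §4 (G(ℓ', ℓ] and G(ℓ_{i+1}, ℓ_i])] -/
def slab (η : HeightSystem G o) (j : ℕ) : Set V :=
  {v | η.ratio ^ (j + 1) < η.height v ∧ η.height v ≤ η.ratio ^ j}

/-- Membership in a slab, unfolded. [folklore] -/
theorem mem_slab_iff (η : HeightSystem G o) {j : ℕ} {v : V} :
    v ∈ η.slab j ↔ η.ratio ^ (j + 1) < η.height v ∧ η.height v ≤ η.ratio ^ j :=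
  Iff.rfl

/-- `o ∈ G(ℓ_1, ℓ_0]`. [folklore] -/
theorem mem_slab_zero [G.LocallyFinite] (η : HeightSystem G o) (hconn : G.Connected) :
    o ∈ η.slab 0 := by
  rw [mem_slab_iff, η.height_base hconn, zero_add, pow_one, pow_zero]
  exact ⟨η.ratio_lt_one, le_rfl⟩

/-- **The slabs are pairwise disjoint.** [cite: Timar2006, §4 (Lemma 4.2: pairwise disjoint separating sets of levels)] -/
theorem slab_disjoint (η : HeightSystem G o) {i j : ℕ} (h : i ≠ j) :
    Disjoint (η.slab i) (η.slab j) := by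
  wlog hij : i < j generalizing i j
  · exact (this h.symm (lt_of_le_of_ne (not_lt.1 hij) h.symm)).symm
  rw [Set.disjoint_left]
  rintro v ⟨hi, -⟩ ⟨-, hj⟩
  have : η.ratio ^ j ≤ η.ratio ^ (i + 1) := η.ratio_pow_le_pow_iff.2 hij
  exact absurd (lt_of_lt_of_le hi (hj.trans this)) (lt_irrefl _)

/-- **Every vertex of height at most `1 = h(o)` lies in exactly one slab** `G(ℓ_{j+1}, ℓ_j]`,
`j ∈ ℕ` ("`⋃_i L_i` contains all the vertices below `o`", the hypothesis of Lemma 4.2, for the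
grid slabs). [cite: Timar2006, §4 (Lemma 4.2 and proof of Thm. 4.3: the slabs cover everything below o)] -/
theorem exists_unique_mem_slab [G.LocallyFinite] (η : HeightSystem G o) (hconn : G.Connected) {v : V}
    (hv : η.height v ≤ 1) : ∃! j : ℕ, v ∈ η.slab j := by
  classical
  -- existence: `Δ^n → 0 < h(v)`, take the first `n` with `Δ^n < h(v)`; it is `≥ 1`
  have hex : ∃ n : ℕ, η.ratio ^ n < η.height v := by
    have hlim := ENNReal.tendsto_pow_atTop_nhds_zero_iff.2 η.ratio_lt_one
    exact ((hlim.eventually (gt_mem_nhds (pos_iff_ne_zero.2 (η.height_ne_zero hconn v))))).exists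
  have hn_spec : η.ratio ^ Nat.find hex < η.height v := Nat.find_spec hex
  have hn0 : Nat.find hex ≠ 0 := by
    intro h0
    rw [h0, pow_zero] at hn_spec
    exact absurd hv (not_le.2 hn_spec)
  obtain ⟨j, hj⟩ := Nat.exists_eq_succ_of_ne_zero hn0
  rw [hj] at hn_spec
  have hj' : ¬ η.ratio ^ j < η.height v :=
    Nat.find_min hex (by rw [hj]; exact Nat.lt_succ_self j)
  refine ⟨j, ⟨hn_spec, not_lt.1 hj'⟩, fun i hi => ?_⟩
  -- uniqueness: slabs are disjoint
  by_contra hne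
  exact Set.disjoint_left.1 (η.slab_disjoint hne) hi ⟨hn_spec, not_lt.1 hj'⟩

/-- **The slabs separate** ("there is no path from the vertices above `l_1` to the vertices
below `l_2` that is disjoint from `L`", here for `L = G(ℓ_{j+1}, ℓ_j]`): a walk from a vertex of
height `> Δ^j` to a vertex of height `≤ Δ^j` passes through `slab j` — the first vertex of
height `≤ Δ^j` along the walk has height `> Δ^{j+1}`, because one edge lowers the height by at
most the factor `Δ`.
[cite: Timar2006, §4 (separating sets of levels; "(G(ℓ_{i+1}, ℓ_i])_i is a sequence of separating sets of levels")] -/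
theorem exists_mem_support_mem_slab (η : HeightSystem G o) (j : ℕ) :
    ∀ {u v : V} (p : G.Walk u v), η.ratio ^ j < η.height u →
      η.height v ≤ η.ratio ^ j → ∃ x ∈ p.support, x ∈ η.slab j
  | _, _, .nil, hu, hv => absurd hv (not_le.2 hu)
  | u, v, .cons (v := u') hadj p, hu, hv => by
    by_cases hu' : η.ratio ^ j < η.height u'
    · obtain ⟨x, hx, hxs⟩ := exists_mem_support_mem_slab η j p hu' hv
      have hmem : x ∈ (SimpleGraph.Walk.cons hadj p).support := by
        rw [SimpleGraph.Walk.support_cons]; exact List.mem_cons_of_mem _ hx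
      exact ⟨x, hmem, hxs⟩
    · have hmem : u' ∈ (SimpleGraph.Walk.cons hadj p).support := by
        rw [SimpleGraph.Walk.support_cons]; exact List.mem_cons_of_mem _ p.start_mem_support
      refine ⟨u', hmem, ?_, not_lt.1 hu'⟩
      -- `Δ^{j+1} < Δ h(u) ≤ h(u')`
      calc η.ratio ^ (j + 1) = η.ratio * η.ratio ^ j := by ring
        _ < η.ratio * η.height u := ENNReal.mul_lt_mul_right η.ratio_ne_zero η.ratio_ne_top hu
        _ ≤ η.height u' := η.ratio_mul_height_le hadj

/-- In particular an edge never skips a slab downwards: if `x ∼ y` with `h(x) > Δ^j ≥ h(y)` then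
`y ∈ G(ℓ_{j+1}, ℓ_j]`. [cite: Timar2006, §4 (separating sets of levels)] -/
theorem mem_slab_of_adj (η : HeightSystem G o) {j : ℕ} {x y : V} (hxy : G.Adj x y)
    (hx : η.ratio ^ j < η.height x) (hy : η.height y ≤ η.ratio ^ j) : y ∈ η.slab j := by
  refine ⟨?_, hy⟩
  calc η.ratio ^ (j + 1) = η.ratio * η.ratio ^ j := by ring
    _ < η.ratio * η.height x := ENNReal.mul_lt_mul_right η.ratio_ne_zero η.ratio_ne_top hx
    _ ≤ η.height y := η.ratio_mul_height_le hxy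

/-- A long edge from a vertex of `G(ℓ_{j+1}, ℓ_j]` lands in the next slab `G(ℓ_{j+2}, ℓ_{j+1}]`
(the vertex `x'` of the definition of `G'(x)` lies one slab down).
[cite: Timar2006, §4 (proof of Thm. 4.3: x' and G'(x))] -/
theorem mem_slab_succ_of_height_eq_mul (η : HeightSystem G o) {j : ℕ} {x y : V}
    (hx : x ∈ η.slab j) (hy : η.height y = η.ratio * η.height x) : y ∈ η.slab (j + 1) := by
  obtain ⟨hx1, hx2⟩ := hx
  refine ⟨?_, ?_⟩
  · calc η.ratio ^ (j + 1 + 1) = η.ratio * η.ratio ^ (j + 1) := by ring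
      _ < η.ratio * η.height x := ENNReal.mul_lt_mul_right η.ratio_ne_zero η.ratio_ne_top hx1
      _ = η.height y := hy.symm
  · calc η.height y = η.ratio * η.height x := hy
      _ ≤ η.ratio * η.ratio ^ j := by gcongr
      _ = η.ratio ^ (j + 1) := by ring

/-! ### Slabs of arbitrary position -/

/-- A **slab** `{v : a < h(v) ≤ b}` of heights (Timár 2006, §5: "a set of the form
`L = {x : μ^a < w(x) ≤ μ^b}`"; the width condition, here `a ≤ Δ b`, is imposed where it is used).
[cite: Timar2006, §5 (slabs)] -/
def heightSlab (η : HeightSystem G o) (a b : ℝ≥0∞) : Set V :=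
  {v | a < η.height v ∧ η.height v ≤ b}

/-- Membership in a slab. [cite: Timar2006, §5 (slabs)] -/
@[simp] theorem mem_heightSlab (η : HeightSystem G o) {a b : ℝ≥0∞} {v : V} :
    v ∈ η.heightSlab a b ↔ a < η.height v ∧ η.height v ≤ b := Iff.rfl

/-- The grid slabs are the slabs `(Δ^(j+1), Δ^j]`. [cite: Timar2006, §5 ("Every separating set of levels … is a slab")] -/
theorem slab_eq_heightSlab (η : HeightSystem G o) (j : ℕ) :
    η.slab j = η.heightSlab (η.ratio ^ (j + 1)) (η.ratio ^ j) := rfl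

/-- **A slab separates the levels below it from the levels above it** (Timár 2006, §5): if
`a ≤ Δ b`, every walk from a vertex of height `> b` to a vertex of height `≤ b` visits the slab
`(a, b]`. [cite: Timar2006, §5 ("a slab separates the levels below it from the levels above it")] -/
theorem exists_mem_heightSlab_of_walk (η : HeightSystem G o) {a b : ℝ≥0∞} (hab : a ≤ η.ratio * b)
    (hbT : b ≠ ⊤) :
    ∀ {u v : V} (p : G.Walk u v), b < η.height u → η.height v ≤ b →
      ∃ x ∈ p.support, x ∈ η.heightSlab a b
  | _, _, .nil, hu, hv => absurd hv (not_le.2 hu)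
  | u, v, .cons (v := u') hadj p, hu, hv => by
    by_cases hu' : b < η.height u'
    · obtain ⟨x, hx, hxs⟩ := exists_mem_heightSlab_of_walk η hab hbT p hu' hv
      exact ⟨x, (by rw [SimpleGraph.Walk.support_cons]; exact List.mem_cons_of_mem _ hx), hxs⟩
    · refine ⟨u', ?_, ?_, not_lt.1 hu'⟩
      · rw [SimpleGraph.Walk.support_cons]; exact List.mem_cons_of_mem _ p.start_mem_support
      calc a ≤ η.ratio * b := hab
        _ < η.ratio * η.height u := ENNReal.mul_lt_mul_right η.ratio_ne_zero η.ratio_ne_top hu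
        _ ≤ η.height u' := η.ratio_mul_height_le hadj

/-- A walk avoiding a separating slab and starting above it stays above it.
[cite: Timar2006, §5 (slabs separate)] -/
theorem lt_height_of_walk_avoiding (η : HeightSystem G o) {a b : ℝ≥0∞} (hab : a ≤ η.ratio * b)
    (hbT : b ≠ ⊤) {u v : V} (p : G.Walk u v) (hu : b < η.height u)
    (havoid : ∀ x ∈ p.support, x ∉ η.heightSlab a b) : b < η.height v := by
  by_contra hv
  obtain ⟨x, hx, hxs⟩ := η.exists_mem_heightSlab_of_walk hab hbT p hu (not_lt.1 hv)
  exact havoid x hx hxs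

/-! ### The descending long-edge sequence -/

/-- **The descending long-edge sequence** from `x`: `x_0 = x` and `x_{n+1}` a neighbour of
`x_n` of height exactly `Δ h(x_n)` (a path "down to a lower level" along long edges).
[cite: Timar2006, §4 (proof of Thm. 4.3: long edges)] -/
def downSeq (η : HeightSystem G o) (x : V) : ℕ → V
  | 0 => x
  | n + 1 => Classical.choose (η.exists_adj_height_eq (downSeq η x n))

/-- `x_0 = x`. [folklore] -/
@[simp] theorem downSeq_zero (η : HeightSystem G o) (x : V) : η.downSeq x 0 = x := rfl

/-- Consecutive terms of the descending sequence are adjacent. [folklore] -/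
theorem downSeq_adj (η : HeightSystem G o) (x : V) (n : ℕ) :
    G.Adj (η.downSeq x n) (η.downSeq x (n + 1)) :=
  (Classical.choose_spec (η.exists_adj_height_eq (η.downSeq x n))).1

/-- Each step goes down by exactly the factor `Δ`. [folklore] -/
theorem height_downSeq_succ (η : HeightSystem G o) (x : V) (n : ℕ) :
    η.height (η.downSeq x (n + 1)) = η.ratio * η.height (η.downSeq x n) :=
  (Classical.choose_spec (η.exists_adj_height_eq (η.downSeq x n))).2

/-- `h(x_n) = Δ^n h(x)`. [cite: Timar2006, §4 (proof of Thm. 4.3: ℓ_i has weight Δ^i)] -/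
theorem height_downSeq (η : HeightSystem G o) (x : V) (n : ℕ) :
    η.height (η.downSeq x n) = η.ratio ^ n * η.height x := by
  induction n with
  | zero => rw [downSeq_zero, pow_zero, one_mul]
  | succ n ih => rw [η.height_downSeq_succ, ih, pow_succ]; ring

/-- The heights along the descending sequence decrease strictly. [folklore] -/
theorem height_downSeq_lt [G.LocallyFinite] (η : HeightSystem G o) (hconn : G.Connected) (x : V)
    {m n : ℕ} (h : m < n) : η.height (η.downSeq x n) < η.height (η.downSeq x m) := by
  rw [η.height_downSeq, η.height_downSeq, mul_comm (η.ratio ^ n), mul_comm (η.ratio ^ m)]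
  exact ENNReal.mul_lt_mul_right (η.height_ne_zero hconn x) (η.height_ne_top hconn x)
    (η.ratio_pow_lt_pow h)

/-- The descending sequence is injective. [folklore] -/
theorem injective_downSeq [G.LocallyFinite] (η : HeightSystem G o) (hconn : G.Connected) (x : V) :
    Function.Injective (η.downSeq x) := by
  intro m n hmn
  by_contra hne
  rcases lt_or_gt_of_ne hne with h | h
  · exact absurd (congrArg η.height hmn) (η.height_downSeq_lt hconn x h).ne'
  · exact absurd (congrArg η.height hmn) (η.height_downSeq_lt hconn x h).ne

/-- The first `n` steps of the descending sequence as an `n`-step walk. [folklore] -/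
theorem stepReach_downSeq (η : HeightSystem G o) (x : V) (n : ℕ) :
    StepReach G n x (η.downSeq x n) :=
  ⟨η.downSeq x, rfl, rfl, fun i _ => η.downSeq_adj x i⟩

/-- The descending sequence stays in the ball: `x_n ∈ B(x, n)`. [folklore] -/
theorem downSeq_mem_graphBall (η : HeightSystem G o) (x : V) (n : ℕ) :
    η.downSeq x n ∈ graphBall G x n :=
  (η.stepReach_downSeq x n).mem_graphBall

end HeightSystem

end Literature.Barriers.CriticalPhenomena

end
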